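import Summits.AtomisticToContinuum.Crystallization.Theorems.ChargedEnergyGapExposedTransfer
import Summits.AtomisticToContinuum.Crystallization.Theorems.ChargedEnergyGapGrossCrowding
import HarnessLib

/-!
# `ChargedEnergyGap` — the EXPOSED piece of the gross charge gap is PROVED
# (cell `decomp-a2c`, lens 3, generation 42, node «ExposedTransfer», part C2 of C1/C2)

Leaf of record (critic row 847): `[GE] ExposedGrossPricing (3/20) (1/10) (6/5)` of the exact exposure dial
`grossChargeGap_iff_exposed_compact : GrossChargeGap θ ↔ ExposedGrossPricing θ ε R ∧ CompactGrossGap θ ε R` (part B,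
`ChargedEnergyGapExposureDial`) beneath the gross piece `[G] GrossChargeGap (3/20)` of the chart dial of the shared crux
`PricedLinkCensus.ChargedEnergyGap` (`stmt-AtomisticToContinuum-14231`).

THIS FILE PROVES IT, for every `θ`, every `ε > 0` and every `R ≥ 0` (`exposedGrossPricing_holds`; the instance of record
`exposedGrossPricing_record : ExposedGrossPricing (3/20) (1/10) (6/5)`), indeed the stronger `speciesPricing_motifExposed`:
ALL exposed motif sites (charged or not, charted or not) are priced,
`(ε/2)·#{exposed motif sites of Q} ≤ ((32/5)³ + (6R + 32/5)³ + ε)·#F·(e(Q) − e*)` (`half_mul_motifExposed_le`).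
Consequently the gross piece is EXACTLY its compact residual
(`grossChargeGap_iff_compactGrossGap : GrossChargeGap θ ↔ CompactGrossGap θ ε R`, `ε > 0`, `R ≥ 0`), and the G-side open
mathematics of the 14231 lineage is the compact dial `[GC] = [GC-dense] ∧ [GC-dilute]` of part B §5 and nothing else
(`grossChargeGap_of_compactDial`, `chargedEnergyGap_of_compactDial`).

PROOF (pattern `Blocks.periodicPricing_of_noBoundary`): suppose `(ε/2)·mE > c·#F·(e(Q) − e*)`, slack `δ`.  Choose the
clearance `ρ ≥ max(1, 2R)` with `(64/6)·farSum(ρ) ≤ ε/2` (`exists_farSum_le`), the depth `d = depth(ρ)`, and `K` large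
(`exists_block_energy_le`: blocks are trial states, `E(Q_K) ≤ #F K³ (e(Q) + δ/(3c#F))`; and `6d·(ε/2)·mE·K² ≤ (δ/3)K³`).
In the block `Q_K` (injective, `#F K³` points) the deep block points over `ε`-rattlers are `(ε/2)`-rattlers (part C1
`rattler_block`) and those over sites within `R` of an `ε`-hole `z` are within `R` of the translated hole `z + g_k`, which
clears the block by `1/2` and has block field `≤ e* − ε/2` (part C1 `isHole_add`, `sum_block_field_le`); part D's finite
pricing `card_exposed_le_excess` at `ε/2` gives `(ε/2)·(#Sr + #Sh) ≤ c·(E(Q_K) − #F K³ e*)`, while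
`#Sr + #Sh ≥ (K³ − 6dK²)·mE` (part C1 `card_deep_exposed_ge`, tree `card_deep_ge`) — contradiction as `K → ∞`.

All `[this work]`.
-/

noncomputable section

open scoped BigOperators
open Literature.MathematicalPhysics.StatisticalMechanics
open Literature.Geometry.DiscreteGeometry
open Summit.AtomisticToContinuum.Crystallization.Theses.PricedLinkCensus
open Summit.AtomisticToContinuum.Crystallization.Theorems.ChargedEnergyGapNegative
open Summit.AtomisticToContinuum.Crystallization.Theorems.ChargedEnergyGapNegative.Blocks
open Summit.AtomisticToContinuum.Crystallization.Theorems.ChargedEnergyGapGrossSurgery (card_exposed_le_excess)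

namespace Summit.AtomisticToContinuum.Crystallization.Theorems.ChargedEnergyGapChartDial

/-! ## §1 The transfer: every exposed motif site is priced -/

/-- **THE FINITE PRICING TRANSFERS**: for `ε > 0`, `R ≥ 0` and every periodic `Q`,
`(ε/2)·#{exposed motif sites of Q} ≤ ((32/5)³ + (6R + 32/5)³ + ε)·#F·(e(Q) − e*)`. -/
theorem half_mul_motifExposed_le {ε R : ℝ} (hε : 0 < ε) (hR : 0 ≤ R) (Q : PeriodicConfiguration 3) :
    ε / 2 * (motifExposed ε R Q : ℝ) ≤ ((32 / 5 : ℝ) ^ 3 + (6 * R + 32 / 5) ^ 3 + ε) * excess Q := by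
  classical
  set c := (32 / 5 : ℝ) ^ 3 + (6 * R + 32 / 5) ^ 3 + ε with hc
  have hcpos : 0 < c := by positivity
  by_contra hlt
  push Not at hlt
  have hF : (0 : ℝ) < Q.motif.card := by exact_mod_cast Q.motif_nonempty.card_pos
  have hX : 0 ≤ excess Q := excess_nonneg' Q
  set mE := (motifExposed ε R Q : ℝ) with hmE
  have hmE0 : 0 ≤ mE := Nat.cast_nonneg _
  set δ := ε / 2 * mE - c * excess Q with hδ
  have hδ0 : 0 < δ := by rw [hδ]; linarith
  -- the clearance `ρ`: tails below `3ε/64`, `ρ ≥ 1`, `ρ ≥ 2R`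
  obtain ⟨ρ₀, hρ₀⟩ := exists_farSum_le Q (show 0 < 3 * ε / 64 by positivity)
  set ρ := max ρ₀ (max 1 (2 * R)) with hρdef
  have hfarSum : farSum Q ρ ≤ 3 * ε / 64 := hρ₀ ρ (le_max_left _ _)
  have hρ1 : (1 : ℝ) ≤ ρ := (le_max_left _ _).trans (le_max_right _ _)
  have hρR : 2 * R ≤ ρ := (le_max_right _ _).trans (le_max_right _ _)
  have hρ9 : (9 : ℝ) / 10 ≤ ρ := by linarith
  have hρ0 : 0 < ρ := by linarith
  set d := depth Q ρ with hd
  -- blocks are trial states with slack `δ / (3 c #F)` per particle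
  obtain ⟨K₀, hK₀, hK⟩ := exists_block_energy_le Q (show 0 < δ / (3 * c * Q.motif.card) by positivity)
  obtain ⟨K₁, hK₁⟩ := exists_nat_gt (18 * d * (ε / 2) * mE / δ)
  set K := max K₀ (max (6 * d) (K₁ + 1)) with hKdef
  have hKK₀ : K₀ ≤ K := le_max_left _ _
  have hKK₁ : K₁ + 1 ≤ K := (le_max_right _ _).trans (le_max_right _ _)
  have hKpos : (0 : ℝ) < K := by exact_mod_cast lt_of_lt_of_le hK₀ hKK₀
  have hK1r : (K₁ : ℝ) + 1 ≤ K := by exact_mod_cast hKK₁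
  have hn : ((Fintype.card (BIdx Q K) : ℕ) : ℝ) = Q.motif.card * (K : ℝ) ^ 3 := by
    exact_mod_cast card_BIdx Q K
  have hE := hK K hKK₀
  rw [hn] at hE
  -- the two exposed families of the block, labelled by `Fin (#F K³)`, and their holes
  have hzx : ∀ x : Q.motif, NearHole ε R Q x → ∃ z : E3, dist (x : E3) z ≤ R ∧ IsHole ε Q z := fun x h => h
  choose! zf hzf using hzx
  obtain ⟨hole, hhole⟩ : ∃ hole : Fin (Fintype.card (BIdx Q K)) → E3, ∀ a, hole a =
      zf ((Fintype.equivFin (BIdx Q K)).symm a).1 + latVec Q (coords K ((Fintype.equivFin (BIdx Q K)).symm a).2) :=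
    ⟨_, fun a => rfl⟩
  set Sr := Finset.univ.filter fun a : Fin (Fintype.card (BIdx Q K)) =>
    IsDeep K d ((Fintype.equivFin (BIdx Q K)).symm a).2 ∧ Rattler ε Q ((Fintype.equivFin (BIdx Q K)).symm a).1
    with hSr
  set Sh := Finset.univ.filter fun a : Fin (Fintype.card (BIdx Q K)) =>
    IsDeep K d ((Fintype.equivFin (BIdx Q K)).symm a).2 ∧ NearHole ε R Q ((Fintype.equivFin (BIdx Q K)).symm a).1
    with hSh
  have hSr' : ∀ a ∈ Sr, eStar + ε / 2 ≤
      Literature.MathematicalPhysics.StatisticalMechanics.siteEnergy lennardJones (blockConfig Q K) a := by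
    intro a ha
    obtain ⟨hdp, hr⟩ := (Finset.mem_filter.1 ha).2
    have h := rattler_block Q K hρ9 hdp hr
    rw [Equiv.apply_symm_apply] at h
    linarith
  have hnear' : ∀ a ∈ Sh, dist (bpt Q K ((Fintype.equivFin (BIdx Q K)).symm a)) (hole a) ≤ R := by
    intro a ha
    obtain ⟨-, hh⟩ := (Finset.mem_filter.1 ha).2
    rw [hhole]
    unfold bpt
    rw [dist_add_right]
    exact (hzf _ hh).1
  have hnear : ∀ a ∈ Sh, dist (blockConfig Q K a) (hole a) ≤ R := by
    intro a ha
    rw [blockConfig_apply]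
    exact hnear' a ha
  have hfar : ∀ a ∈ Sh, ∀ b, (1 : ℝ) / 2 ≤ dist (hole a) (blockConfig Q K b) := by
    intro a ha b
    obtain ⟨-, hh⟩ := (Finset.mem_filter.1 ha).2
    have hH := isHole_add Q (latVec_mem Q (coords K ((Fintype.equivFin (BIdx Q K)).symm a).2)) (hzf _ hh).2
    rw [blockConfig_apply, hhole]
    exact hH.1 _ (bpt_mem Q K _)
  have hfield : ∀ a ∈ Sh, ChargedEnergyGapGrossSurgery.holeField (blockConfig Q K) (hole a) ≤ eStar - ε / 2 := by
    intro a ha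
    obtain ⟨hdp, hh⟩ := (Finset.mem_filter.1 ha).2
    have hH := isHole_add Q (latVec_mem Q (coords K ((Fintype.equivFin (BIdx Q K)).symm a).2)) (hzf _ hh).2
    rw [← hhole] at hH
    have hb := sum_block_field_le Q K hρR hρ0 hdp hH (hnear' a ha)
    have hfx : farSix Q (((Fintype.equivFin (BIdx Q K)).symm a).1 : E3) ρ ≤ farSum Q ρ :=
      Finset.single_le_sum (s := Q.motif) (f := fun x => farSix Q x ρ) (fun x _ => farSix_nonneg Q x ρ)
        ((Fintype.equivFin (BIdx Q K)).symm a).1.2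
    rw [holeField_blockConfig]
    linarith
  have hfin := card_exposed_le_excess (blockConfig_injective Q K) (by positivity : (0 : ℝ) ≤ ε / 2) hR Sr Sh hSr'
    hole hnear hfar hfield
  rw [hn] at hfin
  have hcc : (32 / 5 : ℝ) ^ 3 + (6 * R + 32 / 5) ^ 3 + 2 * (ε / 2) = c := by rw [hc]; ring
  rw [hcc] at hfin
  -- counting: `(K³ − 6dK²)·mE ≤ #Sr + #Sh`
  have hSe : ((Finset.univ.filter fun a : Fin (Fintype.card (BIdx Q K)) =>
      IsDeep K d ((Fintype.equivFin (BIdx Q K)).symm a).2 ∧ Exposed ε R Q ((Fintype.equivFin (BIdx Q K)).symm a).1).card : ℝ) ≤ (Sr.card : ℝ) + Sh.card := by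
    have hsub : (Finset.univ.filter fun a : Fin (Fintype.card (BIdx Q K)) =>
        IsDeep K d ((Fintype.equivFin (BIdx Q K)).symm a).2 ∧ Exposed ε R Q ((Fintype.equivFin (BIdx Q K)).symm a).1) ⊆ Sr ∪ Sh := by
      intro a ha
      obtain ⟨hdp, hx⟩ := (Finset.mem_filter.1 ha).2
      rcases hx with hx | hx
      · exact Finset.mem_union.2 (Or.inl (Finset.mem_filter.2 ⟨Finset.mem_univ _, hdp, hx⟩))
      · exact Finset.mem_union.2 (Or.inr (Finset.mem_filter.2 ⟨Finset.mem_univ _, hdp, hx⟩))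
    exact_mod_cast (Finset.card_le_card hsub).trans (Finset.card_union_le _ _)
  have hcnt := card_deep_exposed_ge Q K d ε R
  have hdeep := card_deep_ge K d
  have hfilt := card_filter_equivFin Q K (fun u => IsDeep K d u.2 ∧ Exposed ε R Q u.1)
  have hchR : ((K : ℝ) ^ 3 - 6 * d * (K : ℝ) ^ 2) * mE ≤ (Sr.card : ℝ) + Sh.card := by
    have h1 : ((K : ℝ) ^ 3 - 6 * d * (K : ℝ) ^ 2) ≤ (Nat.card {k : Fin 3 → Fin K // IsDeep K d k} : ℝ) := by
      have := (Nat.cast_le (α := ℝ)).2 hdeep; push_cast at this ⊢; linarith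
    have h2 : ((Nat.card {k : Fin 3 → Fin K // IsDeep K d k} : ℕ) : ℝ) * mE ≤
        (Nat.card {u : BIdx Q K // IsDeep K d u.2 ∧ Exposed ε R Q u.1} : ℝ) := by
      rw [hmE]; exact_mod_cast hcnt
    have h3 : (Nat.card {u : BIdx Q K // IsDeep K d u.2 ∧ Exposed ε R Q u.1} : ℝ) ≤ (Sr.card : ℝ) + Sh.card := by
      rw [← hfilt]; exact hSe
    have h4 := mul_le_mul_of_nonneg_right h1 hmE0
    linarith
  -- `6d·(ε/2)·mE·K² ≤ (δ/3)·K³`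
  have hsmall : 6 * d * (ε / 2) * mE * (K : ℝ) ^ 2 ≤ δ / 3 * (K : ℝ) ^ 3 := by
    have h1 : 18 * d * (ε / 2) * mE / δ < K := by linarith
    rw [div_lt_iff₀ hδ0] at h1
    have hK2 : (0 : ℝ) ≤ (K : ℝ) ^ 2 := by positivity
    have h2 := mul_le_mul_of_nonneg_right h1.le hK2
    linarith
  -- combine
  have hmono : ε / 2 * (((K : ℝ) ^ 3 - 6 * d * (K : ℝ) ^ 2) * mE) ≤ ε / 2 * ((Sr.card : ℝ) + Sh.card) :=
    mul_le_mul_of_nonneg_left hchR (by positivity)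
  have hK3 : (0 : ℝ) < (K : ℝ) ^ 3 := by positivity
  have key : (K : ℝ) ^ 3 * (ε / 2 * mE - δ / 3) ≤ (K : ℝ) ^ 3 * (c * excess Q + δ / 3) := by
    have hE' : c * (interactionEnergy lennardJones (blockConfig Q K) -
        (Q.motif.card : ℝ) * (K : ℝ) ^ 3 * eStar) ≤ (K : ℝ) ^ 3 * (c * excess Q) + (K : ℝ) ^ 3 * (δ / 3) := by
      have : c * ((Q.motif.card : ℝ) * (K : ℝ) ^ 3 * (δ / (3 * c * Q.motif.card))) = (K : ℝ) ^ 3 * (δ / 3) := by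
        field_simp
      have h2 : c * (interactionEnergy lennardJones (blockConfig Q K) - (Q.motif.card : ℝ) * (K : ℝ) ^ 3 * eStar) ≤
          c * ((Q.motif.card : ℝ) * (K : ℝ) ^ 3 * (Q.energyPerParticle lennardJones + δ / (3 * c * Q.motif.card)) -
            (Q.motif.card : ℝ) * (K : ℝ) ^ 3 * eStar) := mul_le_mul_of_nonneg_left (by linarith) hcpos.le
      have h3 : c * ((Q.motif.card : ℝ) * (K : ℝ) ^ 3 * (Q.energyPerParticle lennardJones + δ / (3 * c * Q.motif.card)) -
            (Q.motif.card : ℝ) * (K : ℝ) ^ 3 * eStar) = (K : ℝ) ^ 3 * (c * excess Q) + (K : ℝ) ^ 3 * (δ / 3) := by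
        rw [← this]; simp only [excess]; ring
      linarith
    linarith [hmono, hfin, hE', hsmall]
  have := le_of_mul_le_mul_left key hK3
  rw [hδ] at this
  linarith

/-- **All exposed motif sites are priced** (`ε > 0`, `R ≥ 0`): `SpeciesPricing (motifExposed ε R)`. -/
theorem speciesPricing_motifExposed {ε R : ℝ} (hε : 0 < ε) (hR : 0 ≤ R) : SpeciesPricing (motifExposed ε R) := by
  have hc : (0 : ℝ) < (32 / 5 : ℝ) ^ 3 + (6 * R + 32 / 5) ^ 3 + ε := by positivity
  refine ⟨ε / 2 / ((32 / 5 : ℝ) ^ 3 + (6 * R + 32 / 5) ^ 3 + ε), by positivity, fun Q => ?_⟩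
  rw [div_mul_eq_mul_div, div_le_iff₀ hc]
  have := half_mul_motifExposed_le hε hR Q
  linarith

/-! ## §2 The leaf `[GE]` and the exact collapse of the gross piece to its compact residual -/

/-- **`[GE]` PROVED**: `ExposedGrossPricing θ ε R` for every `θ`, every `ε > 0`, every `R ≥ 0`. -/
theorem exposedGrossPricing_holds (θ : ℝ) {ε R : ℝ} (hε : 0 < ε) (hR : 0 ≤ R) : ExposedGrossPricing θ ε R :=
  (speciesPricing_motifExposed hε hR).mono fun Q => motifGrossExposed_le_motifExposed θ ε R Q

/-- The leaf of record of critic row 847: `ExposedGrossPricing (3/20) (1/10) (6/5)`. -/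
theorem exposedGrossPricing_record : ExposedGrossPricing (3 / 20) (1 / 10) (6 / 5) :=
  exposedGrossPricing_holds _ (by norm_num) (by norm_num)

/-- **The gross piece IS its compact residual**: `GrossChargeGap θ ↔ CompactGrossGap θ ε R` (`ε > 0`, `R ≥ 0`). -/
theorem grossChargeGap_iff_compactGrossGap (θ : ℝ) {ε R : ℝ} (hε : 0 < ε) (hR : 0 ≤ R) :
    GrossChargeGap θ ↔ CompactGrossGap θ ε R :=
  ⟨fun h => compactGrossGap_of_grossChargeGap ε R h,
    fun h => grossChargeGap_of_exposed_compact (exposedGrossPricing_holds θ hε hR) h⟩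

/-- The record instance: `GrossChargeGap (3/20) ↔ CompactGrossGap (3/20) (1/10) (6/5)`. -/
theorem grossChargeGap_iff_compactGrossGap_record :
    GrossChargeGap (3 / 20) ↔ CompactGrossGap (3 / 20) (1 / 10) (6 / 5) :=
  grossChargeGap_iff_compactGrossGap _ (by norm_num) (by norm_num)

/-- **The G-side cone of record after this file**: the compact residual in its dense/dilute form alone gives the gross piece —
`UniversalCompetitor (compact) φ₀ → DilutePricing (compact) φ₀ → GrossChargeGap θ` (`ε > 0`, `R ≥ 0`, any `φ₀`). -/
theorem grossChargeGap_of_compactDial {θ ε R φ₀ : ℝ} (hε : 0 < ε) (hR : 0 ≤ R)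
    (hU : UniversalCompetitor (motifGrossCompact θ ε R) φ₀) (hD : DilutePricing (motifGrossCompact θ ε R) φ₀) :
    GrossChargeGap θ :=
  grossChargeGap_of_exposureDial (exposedGrossPricing_holds θ hε hR) hU hD

/-- … and with the charted piece, the crux: `UniversalCompetitor → DilutePricing → ChartedChargePricing θ → ChargedEnergyGap`. -/
theorem chargedEnergyGap_of_compactDial {θ ε R φ₀ : ℝ} (hε : 0 < ε) (hR : 0 ≤ R)
    (hU : UniversalCompetitor (motifGrossCompact θ ε R) φ₀) (hD : DilutePricing (motifGrossCompact θ ε R) φ₀)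
    (hP : ChartedChargePricing θ) : ChargedEnergyGap :=
  chargedEnergyGap_of_exposureDial (exposedGrossPricing_holds θ hε hR) hU hD hP

end Summit.AtomisticToContinuum.Crystallization.Theorems.ChargedEnergyGapChartDial

end
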